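import Summits.Ventures.PercRepro.GZSwapA

/-!
# The K-swap of Gladkov–Zimin at the class level — part B (the sealed swap `σ₇₂`, Theorem 8.2)

Continuation of `GZSwapA` (the module docstring there lists every declaration of the four parts
`GZSwapA` → `GZSwapB` → `GZSwapC` → `GZSwap`; the split is the gate's 400-line limit, proofs unchanged).
-/

namespace PercRepro

namespace MultiGraph

/-! ### The K-swap with `M = Com_c(S)` sealed (`σ₇₂`), Theorem 8.2 -/

section Sealed

variable {V E : Type*} (G : MultiGraph V E)

/-- The cells of three marks, by connectivity: all separate (`bot`). -/
def IsBot (ω : Config E) (a b c : V) : Prop := ¬ G.Conn ω a b ∧ ¬ G.Conn ω a c ∧ ¬ G.Conn ω b c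

/-- Exactly one pair joined (`ab|c`, `ac|b` or `bc|a`): the target cells of the C-017 class lemma. -/
def OnePair (ω : Config E) (a b c : V) : Prop :=
  (G.Conn ω a b ∧ ¬ G.Conn ω a c) ∨ (G.Conn ω a c ∧ ¬ G.Conn ω a b) ∨
    (G.Conn ω b c ∧ ¬ G.Conn ω a b)

open Classical in
/-- **The sealed K-swap** `σ₇₂(S) = S Δ (E[Com_a(S)] ∖ E[Com_c(S)])`: the edges at the cluster of `a`
are flipped, except those at the cluster of `c`. -/
noncomputable def kSwapSealed (a c : V) (ω : Config E) : Config E :=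
  fun e => if e ∈ G.edgesAt (G.cluster ω a) ∧ e ∉ G.edgesAt (G.cluster ω c) then !ω e else ω e

/-- The sealed swap flips the edges at `K` away from `M`. -/
theorem kSwapSealed_apply_of_flip {a c : V} {ω : Config E} {e : E}
    (hK : e ∈ G.edgesAt (G.cluster ω a)) (hM : e ∉ G.edgesAt (G.cluster ω c)) :
    G.kSwapSealed a c ω e = !ω e := by
  simp [kSwapSealed, hK, hM]

/-- The sealed swap keeps the edges at `M`. -/
theorem kSwapSealed_apply_of_mem_c {a c : V} {ω : Config E} {e : E}
    (hM : e ∈ G.edgesAt (G.cluster ω c)) : G.kSwapSealed a c ω e = ω e := by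
  simp [kSwapSealed, hM]

/-- The sealed swap keeps the edges away from `K`. -/
theorem kSwapSealed_apply_of_notMem {a c : V} {ω : Config E} {e : E}
    (hK : e ∉ G.edgesAt (G.cluster ω a)) : G.kSwapSealed a c ω e = ω e := by
  simp [kSwapSealed, hK]

/-- **`M` is sealed** (Lemma 8.2a): the cluster of `c` in `σ₇₂(S)` is the cluster of `c` in `S`. -/
theorem cluster_kSwapSealed_c (a c : V) (ω : Config E) :
    G.cluster (G.kSwapSealed a c ω) c = G.cluster ω c :=
  cluster_eq_of_agree fun _ he => (G.kSwapSealed_apply_of_mem_c he).symm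

/-- Two clusters meeting are equal: `v ∈ Com_a ∩ Com_c` forces `c ∈ Com_a`. -/
theorem mem_cluster_of_mem_inter {ω : Config E} {a c v : V} (ha : v ∈ G.cluster ω a)
    (hc : v ∈ G.cluster ω c) : c ∈ G.cluster ω a := by
  simp only [mem_cluster] at ha hc ⊢
  exact ha.trans hc.symm

/-- **Lemma 8.2b**: from the cell `bot`, if the sealed swap joins `a` and `b`, its cell is `ab|c`. -/
theorem onePair_kSwapSealed_of_bot {a b c : V} {ω : Config E} (h : G.IsBot ω a b c)
    (hab : G.Conn (G.kSwapSealed a c ω) a b) :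
    G.Conn (G.kSwapSealed a c ω) a b ∧ ¬ G.Conn (G.kSwapSealed a c ω) a c := by
  refine ⟨hab, fun hac => h.2.1 ?_⟩
  have : a ∈ G.cluster (G.kSwapSealed a c ω) c := by
    rw [mem_cluster]; exact hac.symm
  rw [G.cluster_kSwapSealed_c, mem_cluster] at this
  exact this.symm

open Classical in
/-- The complement of `τ` with the edges at `Com_c(τ)` closed: the graph in which the decoder of
`σ₇₂` re-reads `Com_a(S)`. -/
noncomputable def sealedCompl (c : V) (τ : Config E) : Config E :=
  fun e => if e ∈ G.edgesAt (G.cluster τ c) then false else !τ e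

/-- `sealedCompl` off `E[M]`. -/
theorem sealedCompl_apply_of_notMem {c : V} {τ : Config E} {e : E}
    (hM : e ∉ G.edgesAt (G.cluster τ c)) : G.sealedCompl c τ e = !τ e := by
  simp [sealedCompl, hM]

/-- `sealedCompl` on `E[M]`. -/
theorem sealedCompl_apply_of_mem {c : V} {τ : Config E} {e : E}
    (hM : e ∈ G.edgesAt (G.cluster τ c)) : G.sealedCompl c τ e = false := by
  simp [sealedCompl, hM]

/-- An open edge at two clusters that are not the same cluster is impossible: if `ω e = true` has an
endpoint in `Com_a` and an endpoint in `Com_c` then `c ∈ Com_a`. -/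
theorem mem_cluster_of_open_edgesAt {ω : Config E} {a c : V} {e : E} (he : ω e = true)
    (hK : e ∈ G.edgesAt (G.cluster ω a)) (hM : e ∈ G.edgesAt (G.cluster ω c)) :
    c ∈ G.cluster ω a := by
  have hK' : G.fst e ∈ G.cluster ω a := by
    rcases hK with h | h
    · exact h
    · exact (G.mem_cluster_iff_of_open he).mpr h
  have hM' : G.fst e ∈ G.cluster ω c := by
    rcases hM with h | h
    · exact h
    · exact (G.mem_cluster_iff_of_open he).mpr h
  exact G.mem_cluster_of_mem_inter hK' hM'

/-- **The decoder reads `K` back** when `c ∉ K`: the cluster of `a` in the sealed complement of `σ₇₂(S)`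
is `Com_a(S)`. -/
theorem cluster_sealedCompl_kSwapSealed {a c : V} {ω : Config E} (hc : c ∉ G.cluster ω a) :
    G.cluster (G.sealedCompl c (G.kSwapSealed a c ω)) a = G.cluster ω a := by
  refine cluster_eq_of_agree fun e heK => ?_
  have hMeq : G.cluster (G.kSwapSealed a c ω) c = G.cluster ω c := G.cluster_kSwapSealed_c a c ω
  by_cases hM : e ∈ G.edgesAt (G.cluster ω c)
  · have hM' : e ∈ G.edgesAt (G.cluster (G.kSwapSealed a c ω) c) := by rwa [hMeq]
    rw [G.sealedCompl_apply_of_mem hM']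
    cases hω : ω e
    · rfl
    · exact absurd (G.mem_cluster_of_open_edgesAt hω heK hM) hc
  · have hM' : e ∉ G.edgesAt (G.cluster (G.kSwapSealed a c ω) c) := by rwa [hMeq]
    rw [G.sealedCompl_apply_of_notMem hM', G.kSwapSealed_apply_of_flip heK hM, Bool.not_not]

/-- When `c ∈ K` the sealed swap does nothing. -/
theorem kSwapSealed_eq_self {a c : V} {ω : Config E} (hc : c ∈ G.cluster ω a) :
    G.kSwapSealed a c ω = ω := by
  have hKM : G.cluster ω c = G.cluster ω a := by
    ext v
    simp only [mem_cluster] at hc ⊢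
    exact ⟨fun h => hc.trans h, fun h => hc.symm.trans h⟩
  funext e
  by_cases hK : e ∈ G.edgesAt (G.cluster ω a)
  · exact G.kSwapSealed_apply_of_mem_c (by rwa [hKM])
  · exact G.kSwapSealed_apply_of_notMem hK

/-- When `c ∈ K` the decoder reads the singleton `{a}` (every edge at `a` is sealed). -/
theorem cluster_sealedCompl_of_mem {a c : V} {ω : Config E} (hc : c ∈ G.cluster ω a) :
    G.cluster (G.sealedCompl c (G.kSwapSealed a c ω)) a = {a} := by
  rw [G.kSwapSealed_eq_self hc]
  have hKM : G.cluster ω c = G.cluster ω a := by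
    ext v
    simp only [mem_cluster] at hc ⊢
    exact ⟨fun h => hc.trans h, fun h => hc.symm.trans h⟩
  ext v
  simp only [mem_cluster, Set.mem_singleton_iff]
  constructor
  · intro hv
    refine (eq_of_conn_of_isolated (fun e he => ?_) hv)
    by_contra hne
    have heM : e ∈ G.edgesAt (G.cluster ω c) := by
      rw [hKM]
      simp only [edgesAt, Set.mem_setOf_eq, mem_cluster]
      rcases not_and_or.mp hne with h | h
      · exact Or.inl (by rw [not_not.mp h]; exact Conn.refl G ω a)
      · exact Or.inr (by rw [not_not.mp h]; exact Conn.refl G ω a)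
    rw [G.sealedCompl_apply_of_mem heM] at he
    exact absurd he (by decide)
  · intro hv
    subst hv
    exact Conn.refl G _ _

open Classical in
/-- **The decoder of `σ₇₂`**: `inv₇₂(T) = T Δ (E[K'] ∖ E[Com_c(T)])` with `K'` the cluster of `a` in the
sealed complement of `T`. -/
noncomputable def kSwapSealedInv (a c : V) (τ : Config E) : Config E :=
  fun e => if e ∈ G.edgesAt (G.cluster (G.sealedCompl c τ) a) ∧ e ∉ G.edgesAt (G.cluster τ c)
    then !τ e else τ e

/-- **Lemma 8.2a (inverse)**: the decoder recovers `S` from `σ₇₂(S)`. -/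
theorem kSwapSealedInv_kSwapSealed (a c : V) (ω : Config E) :
    G.kSwapSealedInv a c (G.kSwapSealed a c ω) = ω := by
  funext e
  have hMeq : G.cluster (G.kSwapSealed a c ω) c = G.cluster ω c := G.cluster_kSwapSealed_c a c ω
  by_cases hc : c ∈ G.cluster ω a
  · -- nothing was flipped and nothing is flipped back
    have hK' := G.cluster_sealedCompl_of_mem hc
    have hself := G.kSwapSealed_eq_self hc
    have hKM : G.cluster ω c = G.cluster ω a := by
      ext v
      simp only [mem_cluster] at hc ⊢
      exact ⟨fun h => hc.trans h, fun h => hc.symm.trans h⟩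
    rw [hself] at hK' ⊢
    unfold kSwapSealedInv
    rw [hK', hKM]
    rw [if_neg]
    rintro ⟨h1, h2⟩
    apply h2
    simp only [edgesAt, Set.mem_setOf_eq, Set.mem_singleton_iff, mem_cluster] at h1 ⊢
    rcases h1 with h1 | h1
    · exact Or.inl (by rw [h1]; exact Conn.refl G ω a)
    · exact Or.inr (by rw [h1]; exact Conn.refl G ω a)
  · have hK' := G.cluster_sealedCompl_kSwapSealed hc
    unfold kSwapSealedInv
    rw [hK', hMeq]
    by_cases hK : e ∈ G.edgesAt (G.cluster ω a)
    · by_cases hM : e ∈ G.edgesAt (G.cluster ω c)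
      · rw [if_neg (fun h => h.2 hM)]
        exact G.kSwapSealed_apply_of_mem_c hM
      · rw [if_pos ⟨hK, hM⟩, G.kSwapSealed_apply_of_flip hK hM, Bool.not_not]
    · rw [if_neg (fun h => hK h.1)]
      exact G.kSwapSealed_apply_of_notMem hK

/-- **The sealed swap is injective** (Lemma 8.2a). -/
theorem kSwapSealed_injective (a c : V) : Function.Injective (G.kSwapSealed a c) :=
  Function.LeftInverse.injective (G.kSwapSealedInv_kSwapSealed a c)

/-! ### Theorem 8.2c: the decodable part of the bad set -/

/-- **The bad configurations** (form (L1) after the pairing): `a ≁_S b` but `a ~ b` in `σ₀(S)`. -/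
def Bad (ω : Config E) (a b : V) : Prop := ¬ G.Conn ω a b ∧ G.Conn (G.kSwap a ω) a b

/-- The residual `bot-2`: bad, all three marks separate, and the sealed swap does not join `a` and `b`. -/
def Bot2 (ω : Config E) (a b c : V) : Prop :=
  G.Bad ω a b ∧ G.IsBot ω a b c ∧ ¬ G.Conn (G.kSwapSealed a c ω) a b

open Classical in
/-- **The decodable map `Φ`**: `σ₇₂` on the cell `bot`, the identity elsewhere. -/
noncomputable def phiDecodable (a b c : V) (ω : Config E) : Config E :=
  if G.IsBot ω a b c then G.kSwapSealed a c ω else ω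

/-- `Φ` maps the decodable bad configurations into the pair cells. -/
theorem onePair_phiDecodable {a b c : V} {ω : Config E} (hbad : G.Bad ω a b)
    (hnot : ¬ G.Bot2 ω a b c) : G.OnePair (G.phiDecodable a b c ω) a b c := by
  unfold phiDecodable
  split_ifs with hbot
  · have hab : G.Conn (G.kSwapSealed a c ω) a b := by
      by_contra h
      exact hnot ⟨hbad, hbot, h⟩
    exact Or.inl (G.onePair_kSwapSealed_of_bot hbot hab)
  · -- not `bot` and `a ≁ b`: the cell is `ac|b` or `bc|a`
    unfold IsBot at hbot
    have hab := hbad.1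
    by_cases hac : G.Conn ω a c
    · exact Or.inr (Or.inl ⟨hac, hab⟩)
    · have hbc : G.Conn ω b c := by
        by_contra hbc
        exact hbot ⟨hab, hac, hbc⟩
      exact Or.inr (Or.inr ⟨hbc, hab⟩)

/-- **THEOREM 8.2c**: `Φ` is injective on the decodable bad configurations. -/
theorem phiDecodable_injOn (a b c : V) :
    Set.InjOn (G.phiDecodable a b c) {ω | G.Bad ω a b ∧ ¬ G.Bot2 ω a b c} := by
  intro ω hω ω' hω' h
  simp only [Set.mem_setOf_eq] at hω hω'
  unfold phiDecodable at h
  by_cases hb : G.IsBot ω a b c <;> by_cases hb' : G.IsBot ω' a b c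
  · rw [if_pos hb, if_pos hb'] at h
    exact G.kSwapSealed_injective a c h
  · -- the image of `ω` is in `ab|c`, the image of `ω'` is `ω'` with `a ≁ b`: impossible
    rw [if_pos hb, if_neg hb'] at h
    exfalso
    have hab : G.Conn (G.kSwapSealed a c ω) a b := by
      by_contra hh
      exact hω.2 ⟨hω.1, hb, hh⟩
    rw [h] at hab
    exact hω'.1.1 hab
  · rw [if_neg hb, if_pos hb'] at h
    exfalso
    have hab : G.Conn (G.kSwapSealed a c ω') a b := by
      by_contra hh
      exact hω'.2 ⟨hω'.1, hb', hh⟩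
    rw [← h] at hab
    exact hω.1.1 hab
  · rw [if_neg hb, if_neg hb'] at h
    exact h

variable [Fintype E] [DecidableEq E]

open Classical in
/-- **The counting form of Theorem 8.2c**: the decodable bad configurations are at most the pair-cell
configurations. -/
theorem card_bad_not_bot2_le_card_onePair (a b c : V) :
    (Finset.univ.filter fun ω : Config E => G.Bad ω a b ∧ ¬ G.Bot2 ω a b c).card ≤
      (Finset.univ.filter fun ω : Config E => G.OnePair ω a b c).card := by
  refine Finset.card_le_card_of_injOn (G.phiDecodable a b c) ?_ ?_
  · intro ω hω
    simp only [Finset.coe_filter, Finset.mem_univ, true_and, Set.mem_setOf_eq] at hω ⊢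
    exact G.onePair_phiDecodable hω.1 hω.2
  · intro ω hω ω' hω' h
    simp only [Finset.coe_filter, Finset.mem_univ, true_and, Set.mem_setOf_eq] at hω hω'
    exact G.phiDecodable_injOn a b c hω hω' h

open Classical in
/-- **The residual statement** (the corollary of Theorem 8.2c): the class lemma
`#bad ≤ #(pair cells)` follows once the `bot-2` configurations are at most the pair-cell
configurations not needed by `Φ`. -/
theorem card_bad_le_of_bot2 (a b c : V)
    (h : (Finset.univ.filter fun ω : Config E => G.Bot2 ω a b c).card ≤
      (Finset.univ.filter fun ω : Config E => G.OnePair ω a b c).card -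
        (Finset.univ.filter fun ω : Config E => G.Bad ω a b ∧ ¬ G.Bot2 ω a b c).card) :
    (Finset.univ.filter fun ω : Config E => G.Bad ω a b).card ≤
      (Finset.univ.filter fun ω : Config E => G.OnePair ω a b c).card := by
  have hsplit : (Finset.univ.filter fun ω : Config E => G.Bad ω a b).card =
      (Finset.univ.filter fun ω : Config E => G.Bot2 ω a b c).card +
        (Finset.univ.filter fun ω : Config E => G.Bad ω a b ∧ ¬ G.Bot2 ω a b c).card := by
    rw [← Finset.card_union_of_disjoint]
    · congr 1
      ext ω
      simp only [Finset.mem_filter, Finset.mem_univ, true_and, Finset.mem_union]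
      constructor
      · intro hb
        by_cases h2 : G.Bot2 ω a b c
        · exact Or.inl h2
        · exact Or.inr ⟨hb, h2⟩
      · rintro (h2 | ⟨hb, _⟩)
        · exact h2.1
        · exact hb
    · rw [Finset.disjoint_left]
      intro ω h1 h2
      simp only [Finset.mem_filter, Finset.mem_univ, true_and] at h1 h2
      exact h2.2 h1
  have hle := G.card_bad_not_bot2_le_card_onePair a b c
  omega

end Sealed

end MultiGraph

end PercRepro
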